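import Summits.AtomisticToContinuum.HydrodynamicLimit.Theorems.CollisionIsometryCLTCollisionalTransferLocalityDefs
import Summits.AtomisticToContinuum.HydrodynamicLimit.Theorems.CollisionIsometryCLTAprioriBoundsInitialMoment
import Literature.MathematicalPhysics.KineticTheory.HardSphereBBGKYLiouvilleFlow
import HarnessLib

/-!
# [E] The all-times energy cap (stub `stub_energyAllTimes`)
(line `hemisphere-affine-slaving`, crux `CollisionalTransferLocality`, stmt-AtomisticToContinuum-9518)

Supporting file (`--supports stmt-AtomisticToContinuum-9518`) of the line lead (gen 1, seat c4, skeleton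
v8), proving the registered stub [E] `stub_energyAllTimes` VERBATIM: for nice profiles `(a₀, θ₀, u₀)`,
`0 < σ ≤ 1/2` and EVERY family of hard-sphere flows `Φ` there is ONE level `E₀ ≥ 0` such that for
EVERY horizon `t` the event "the normalised kinetic energy `(N+1)⁻¹ E(Φ_s z)` exceeds `E₀` at some
`s ∈ [0, t]`" has local-Gibbs probability `→ 0`.

## Proof

* Time zero (`VisitLedgerUpscattering.stub_initialMoment`, line `visit-ledger-upscattering` of the
  crux `AprioriBounds`, landed): there are a rate `λ > 0` and a level `C₀` with
  `P_N {z | C₀ < ∫ e^{λ|v|²} dμ_z} → 0`, `μ_z` the empirical measure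
  (`∫ e^{λ|v|²} dμ_z = (N+1)⁻¹ Σᵢ e^{λ|vᵢ|²}`, `integral_empiricalMeasure`). Its `NiceProfiles` /
  `Flows` have the same bodies as this line's (destructure / `abbrev`).
* Pricing: `λ x ≤ e^{λ x}` (`Real.add_one_le_exp`), so `E(z) = ½ Σᵢ |vᵢ|² ≤ (2λ)⁻¹ Σᵢ e^{λ|vᵢ|²}`
  and on `{∫ e^{λ|v|²} dμ_z ≤ C₀}` the normalised energy is `≤ C₀/(2λ) ≤ E₀ := |C₀|/(2λ)`.
* All times: on the good set of `Φ N` the energy is conserved, `E(Φ_s z) = E(z)` for every real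
  `s` (`HardSphereFlow.configEnergy_flow`), and the local Gibbs law is carried by the good set
  (`localGibbsLaw_eq`, `localGibbsMeasure_absolutelyContinuous`, `HardSphereFlow.measure_compl_good`).
  Hence `bad_N(t) ∩ good ⊆ {C₀ < ∫ e^{λ|v|²} dμ_z}` for every `t` (for `t < 0` the event is empty)
  and `P_N(bad_N(t)) ≤ P_N(goodᶜ) + P_N{C₀ < ∫ …} → 0`.

No new definitions, no named facts; two private helpers; axioms `propext`, `Classical.choice`,
`Quot.sound`.
-/

namespace Summit.AtomisticToContinuum.HydrodynamicLimit.Theorems.HemisphereAffineSlaving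

open scoped BigOperators Topology Classical ENNReal
open Filter Set Function MeasureTheory

noncomputable section

open Literature.MathematicalPhysics.KineticTheory (T3 V3 localGibbsLaw localGibbsLaw_eq
  localGibbsMeasure_absolutelyContinuous)
open Literature.Analysis.FluidPDE (configEnergy empiricalMeasure integral_empiricalMeasure)

/-- Monotonicity of a measure along an inclusion that holds on a conull set `g`:
if `μ gᶜ = 0` and `s ∩ g ⊆ t`, then `μ s ≤ μ t`. -/
private theorem measure_le_of_subset_on {α : Type*} [MeasurableSpace α] {μ : Measure α}
    {g s t : Set α} (hg : μ gᶜ = 0) (h : ∀ x ∈ g, x ∈ s → x ∈ t) : μ s ≤ μ t :=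
  calc μ s ≤ μ (gᶜ ∪ t) := measure_mono fun x hx => by
          by_cases hxg : x ∈ g
          · exact Or.inr (h x hxg hx)
          · exact Or.inl hxg
    _ ≤ μ gᶜ + μ t := measure_union_le _ _
    _ = μ t := by rw [hg, zero_add]

/-- Pricing squares by a Gaussian moment: `Σ xᵢ² ≤ λ⁻¹ Σ e^{λ xᵢ²}` for `λ > 0`
(`λ x ≤ 1 + λ x ≤ e^{λ x}`). -/
private theorem sum_sq_le_inv_mul_sum_exp {ι : Type*} (s : Finset ι) (f : ι → ℝ) {lam : ℝ}
    (hlam : 0 < lam) : ∑ i ∈ s, f i ^ 2 ≤ lam⁻¹ * ∑ i ∈ s, Real.exp (lam * f i ^ 2) := by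
  rw [Finset.mul_sum]
  refine Finset.sum_le_sum fun i _ => ?_
  rw [le_inv_mul_iff₀ hlam]
  linarith [Real.add_one_le_exp (lam * f i ^ 2)]

/-- **[E] ALL-TIMES ENERGY CAP** (registered stub `stub_energyAllTimes` of the line
`hemisphere-affine-slaving`, crux `CollisionalTransferLocality`): for nice profiles, `0 < σ ≤ 1/2` and
every flow family there is ONE level `E₀ ≥ 0` such that for EVERY horizon `t` the event "the
normalised kinetic energy `(N+1)⁻¹ E(Φ_s z)` exceeds `E₀` at some `s ∈ [0, t]`" has local-Gibbs
probability `→ 0`. The time-zero exponential moment bound `VisitLedgerUpscattering.stub_initialMoment`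
(`(N+1)⁻¹ Σᵢ e^{λ|vᵢ|²} ≤ C₀` w.h.p.) prices the energy, `(N+1)⁻¹ E(z) ≤ C₀/(2λ) ≤ |C₀|/(2λ) =: E₀`
(`λ x ≤ e^{λ x}`); energy is conserved along the orbits of the good set
(`HardSphereFlow.configEnergy_flow`), which carries the law (`localGibbsLaw_eq`,
`localGibbsMeasure_absolutelyContinuous`, `HardSphereFlow.measure_compl_good`). -/
theorem stub_energyAllTimes : ∀ (a₀ θ₀ : T3 → ℝ) (u₀ : T3 → V3), NiceProfiles a₀ θ₀ u₀ → ∀ σ : ℝ, 0 < σ → σ ≤ 1 / 2 → ∀ Φ : Flows σ, ∃ E₀ : ℝ, 0 ≤ E₀ ∧ ∀ t : ℝ, Tendsto (fun N : ℕ => Literature.MathematicalPhysics.KineticTheory.localGibbsLaw σ a₀ u₀ θ₀ N (Φ N) {z | ∃ s ∈ Icc 0 t, E₀ < ((N : ℝ) + 1)⁻¹ * Literature.Analysis.FluidPDE.configEnergy ((Φ N).flow s z)}) atTop (𝓝 0) := by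
  intro a₀ θ₀ u₀ hP σ hσ hσ2 Φ
  obtain ⟨ha, hθ, hu, ha0, hθ0⟩ := hP
  -- the time-zero exponential velocity moment bound of the line `visit-ledger-upscattering`
  obtain ⟨lam, hlam, hmom⟩ :=
    VisitLedgerUpscattering.stub_initialMoment a₀ θ₀ u₀ ⟨ha, hθ, hu, ha0, hθ0⟩ σ hσ hσ2 Φ
  obtain ⟨C₀, hC₀⟩ := hmom lam hlam le_rfl
  unfold VisitLedgerUpscattering.InitAt at hC₀
  refine ⟨|C₀| / (2 * lam), by positivity, fun t => ?_⟩
  refine tendsto_of_tendsto_of_tendsto_of_le_of_le tendsto_const_nhds hC₀ (fun _ => zero_le)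
    fun N => ?_
  -- `P_N` is carried by the good set
  have hg : localGibbsLaw σ a₀ u₀ θ₀ N (Φ N) (Φ N).goodᶜ = 0 := by
    rw [localGibbsLaw_eq]
    exact localGibbsMeasure_absolutelyContinuous σ a₀ u₀ θ₀ N (Φ N) (Φ N).measure_compl_good
  refine measure_le_of_subset_on hg fun z hz hbad => ?_
  simp only [mem_setOf_eq] at hbad ⊢
  obtain ⟨s, -, hE⟩ := hbad
  -- conservation of energy along the orbit of the good point `z`
  rw [(Φ N).configEnergy_flow hz s] at hE
  rw [integral_empiricalMeasure]
  by_contra hle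
  push Not at hle
  push_cast at hle
  -- pricing `½ Σ |vᵢ|² ≤ (2λ)⁻¹ Σ e^{λ|vᵢ|²}`
  have hsum : ∑ i, ‖(z i).2‖ ^ 2 ≤ lam⁻¹ * ∑ i, Real.exp (lam * ‖(z i).2‖ ^ 2) :=
    sum_sq_le_inv_mul_sum_exp _ _ hlam
  have hcap : ((N : ℝ) + 1)⁻¹ * configEnergy z ≤ |C₀| / (2 * lam) := by
    unfold configEnergy
    calc ((N : ℝ) + 1)⁻¹ * (2⁻¹ * ∑ i, ‖(z i).2‖ ^ 2)
        ≤ ((N : ℝ) + 1)⁻¹ * (2⁻¹ * (lam⁻¹ * ∑ i, Real.exp (lam * ‖(z i).2‖ ^ 2))) := by gcongr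
      _ = (2 * lam)⁻¹ * (((N : ℝ) + 1)⁻¹ * ∑ i, Real.exp (lam * ‖(z i).2‖ ^ 2)) := by
          rw [mul_inv]; ring
      _ ≤ (2 * lam)⁻¹ * C₀ := by gcongr
      _ ≤ (2 * lam)⁻¹ * |C₀| := by gcongr; exact le_abs_self _
      _ = |C₀| / (2 * lam) := (div_eq_inv_mul _ _).symm
  exact absurd hE (not_lt.2 hcap)

end

end Summit.AtomisticToContinuum.HydrodynamicLimit.Theorems.HemisphereAffineSlaving
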